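import Mathlib.Algebra.BigOperators.Fin
import Literature.Algebra.Lie.ChevalleyEilenbergKugaAdjoint
import HarnessLib

/-!
# The Chevalley–Eilenberg differential of a horizontal cochain on `𝔭`-basis tuples —
crux HeckeEigenvalueField (stmt-Langlands-13632), line Sketch, stub TUPLE-D

Statement.  Let `K ≤ L` be a Lie subalgebra (`𝔨 ≤ 𝔤`), `x : ι → L` a family with
`⁅x i, x j⁆ ∈ K` for all `i, j` (`[𝔭, 𝔭] ⊆ 𝔨`) and `f ∈ C^q(L; M)` a `K`-horizontal cochain
(`i_y f = 0` for `y ∈ K`).  Then for every tuple `I : Fin (q + 1) → ι`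
`(d f)(x_{I 0}, …, x_{I q}) = ∑ᵢ (-1)ⁱ ⁅x_{I i}, f(…, x̂_{I i}, …)⁆`:
the bracket terms `f(⁅x_{I i}, x_{I j}⁆, …)` of the invariant formula
[cite: BorelWallach2000, I §1.1 (2)] have an argument in `𝔨` and vanish.

Proof.  Induction on `q` through the tree's defining recursions (Cartan calculus
[cite: ChevalleyEilenberg1948, §23 (23.5)–(23.6)]): on basis tuples the Lie derivative of a
horizontal cochain is the action on values, `(θ_{x_i} f)(x ∘ J) = ⁅x_i, f (x ∘ J)⁆`
(`i_{x_{J 0}} θ_{x_i} f = θ_{x_i} i_{x_{J 0}} f - i_{⁅x_i, x_{J 0}⁆} f`, the last term dies by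
horizontality, and `i_{x_{J 0}} f` is again horizontal), and Cartan's formula
`i_{x_{I 0}} d f = θ_{x_{I 0}} f - d (i_{x_{I 0}} f)` splits the alternating sum into its `i = 0` term
and (induction hypothesis for the horizontal cochain `i_{x_{I 0}} f`) the terms `i ≥ 1` with the
sign shift `(-1)^{i+1}` (as in the tree's `cochainForm_d_left`).

## References

* A. Borel, N. Wallach, *Continuous cohomology, discrete subgroups, and representations of
  reductive groups*, 2nd ed., Math. Surveys Monogr. 67 (2000), I §1.1 (2)–(5), II §2.2.
  [BorelWallach2000]
* C. Chevalley, S. Eilenberg, *Cohomology theory of Lie groups and Lie algebras*, Trans. Amer.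
  Math. Soc. 63 (1948) 85–124, §23, §28. [ChevalleyEilenberg1948]
-/

set_option linter.dupNamespace false -- project-wide: `Summit.Langlands.Langlands` is the mandated namespace

open Finset
open Literature.Algebra.Lie Literature.Algebra.Lie.ChevalleyEilenberg

namespace Summit.Langlands.Langlands.Theorems.HeckeEigenvalueField.Res

/-- A tuple of members of a family `x` is the cons of its head and its tail (`Fin.cons_self_tail`
in the `Matrix.vecCons` spelling of `ins_apply`). [folklore] -/
theorem vecCons_basisTuple {ι L : Type*} (x : ι → L) {n : ℕ} (J : Fin (n + 1) → ι) :
    Matrix.vecCons (x (J 0)) (fun j => x (J j.succ)) = fun j => x (J j) :=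
  Fin.cons_self_tail (fun j => x (J j))

/-- Consing the head `x_{I 0}` onto the tuple `x ∘ I ∘ succ ∘ i.succAbove` gives the tuple
`x ∘ I ∘ (i.succ).succAbove` (`Fin.succ_succAbove_zero`, `Fin.succ_succAbove_succ`). [folklore] -/
theorem vecCons_basisTuple_succAbove {ι L : Type*} (x : ι → L) {n : ℕ} (I : Fin (n + 2) → ι)
    (i : Fin (n + 1)) :
    Matrix.vecCons (x (I 0)) (fun j => x (I (i.succAbove j).succ)) =
      fun j => x (I (i.succ.succAbove j)) := by
  funext j
  refine Fin.cases ?_ (fun j => ?_) j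
  · simp
  · simp

/-- **On `𝔭`-basis tuples the Lie derivative of a horizontal cochain is the action on values**:
if `⁅x i, x j⁆ ∈ K` for all `j` and `f` is `K`-horizontal, `(θ_{x i} f)(x ∘ J) = ⁅x i, f (x ∘ J)⁆`
— the terms `f(…, ⁅x i, x_{J k}⁆, …)` of [cite: ChevalleyEilenberg1948, §23 (23.3)] have an
argument in `K` (induction on the degree through `i_y θ_x = θ_x i_y - i_{⁅x,y⁆}`, as in the tree's
`cochainForm_lieDer_left`). [cite: BorelWallach2000, II §2.2 (4)] -/
theorem lieDer_apply_basisTuple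
    {R : Type*} [CommRing R] {L : Type*} [LieRing L] [LieAlgebra R L]
    {M : Type*} [AddCommGroup M] [Module R M] [LieRingModule L M] [LieModule R L M]
    (K : LieSubalgebra R L) {ι : Type*} (x : ι → L) (i : ι) (hxi : ∀ j, ⁅x i, x j⁆ ∈ K) :
    ∀ (q : ℕ) {f : Cochain R L M q}, f ∈ horizontal K q → ∀ J : Fin q → ι,
      lieDer R L M q (x i) f (fun j => x (J j)) = ⁅x i, f (fun j => x (J j))⁆
  | 0, f, _, J => lieDer_zero_apply (x i) f _
  | q + 1, f, hf, J => by
    have hfJ : ins q ⁅x i, x (J 0)⁆ f = 0 := (mem_horizontal_succ_iff K q f).1 hf _ (hxi (J 0))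
    have e := congrArg (fun φ : Cochain R L M q => φ (fun j => x (J j.succ)))
      (ins_lieDer (R := R) (M := M) q (x i) (x (J 0)) f)
    simp only [hfJ, sub_zero, ins_apply, vecCons_basisTuple] at e
    rw [e, lieDer_apply_basisTuple K x i hxi q (ins_mem_horizontal K (x (J 0)) hf) (fun j => J j.succ),
      ins_apply, vecCons_basisTuple]

/-- **Stub TUPLE-D — the Chevalley–Eilenberg differential on `𝔭`-basis tuples of a horizontal cochain**:
if `⁅x i, x j⁆ ∈ 𝔨` for all `i, j` and `f` is `𝔨`-horizontal, then
`(d f)(x_{I 0}, …, x_{I q}) = ∑ᵢ (-1)ⁱ x_{I i} · f(…, x̂_{I i}, …)` — the bracket terms of the invariant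
formula have an argument in `𝔨` and die (induction on the degree through Cartan's formula
`i_y d = θ_y - d i_y`, the tree's defining recursion of `d`, as in `cochainForm_d_left`).
[cite: BorelWallach2000, I §1.1 and II §2.2] [cite: ChevalleyEilenberg1948, §23–§28] -/
theorem stub_d_apply_basisTuple
    {R : Type} [CommRing R] {L : Type} [LieRing L] [LieAlgebra R L]
    {M : Type} [AddCommGroup M] [Module R M] [LieRingModule L M] [LieModule R L M]
    (K : LieSubalgebra R L) {ι : Type} (x : ι → L) (hxx : ∀ i j, ⁅x i, x j⁆ ∈ K)
    {q : ℕ} (f : Cochain R L M q) (hf : f ∈ horizontal K q) (I : Fin (q + 1) → ι) :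
    d R L M q f (fun i => x (I i)) =
      ∑ i : Fin (q + 1), ((-1 : R) ^ (i : ℕ)) • ⁅x (I i), f (fun j => x (I (i.succAbove j)))⁆ := by
  induction q with
  | zero =>
    rw [d_zero_apply, Fin.sum_univ_one, Fin.val_zero, pow_zero, one_smul]
    exact congrArg (fun v : Fin 0 → L => ⁅x (I 0), f v⁆) (Subsingleton.elim _ _)
  | succ q ih =>
    -- Cartan's formula `i_{x_{I 0}} (d f) = θ_{x_{I 0}} f - d (i_{x_{I 0}} f)` on the tail tuple
    have e := congrArg (fun φ : Cochain R L M (q + 1) => φ (fun j => x (I j.succ)))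
      (ins_d_succ (R := R) (M := M) q (x (I 0)) f)
    simp only [AlternatingMap.sub_apply, ins_apply, vecCons_basisTuple] at e
    rw [e, lieDer_apply_basisTuple K x (I 0) (hxx (I 0)) (q + 1) hf (fun j => I j.succ),
      ih (ins q (x (I 0)) f) (ins_mem_horizontal K (x (I 0)) hf) (fun j => I j.succ)]
    simp only [ins_apply, vecCons_basisTuple_succAbove]
    rw [Fin.sum_univ_succ (n := q + 1), Fin.succAbove_zero, Fin.val_zero, pow_zero, one_smul,
      sub_eq_add_neg, ← sum_neg_distrib]
    refine congrArg₂ (· + ·) rfl (Finset.sum_congr rfl fun i _ => ?_)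
    rw [Fin.val_succ, pow_succ, mul_neg_one, neg_smul]
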